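import Summits.NavierStokesRegularity.NavierStokesRegularity.Theorems.ScaledTopAlignmentTypeIZoomNonAlignedLimit
import Literature.Analysis.FluidPDE.GigaMiura2011BlowupAnalysis
import HarnessLib

/-!
# Giga–Miura 2011, Theorem 1.1 under (CA′) — PROVED in the tree's Leray–Hopf frame
# (discharge of the Literature facts `gigaMiura2011_scaledAlignment_typeI` and
# `gigaMiura_continuousAlignment_typeI`; support for route `ScaledTopAlignment`, whose door
# W3 = `AprioriScaledTopAlignment` (stmt-NavierStokesRegularity-19901) has (CA′) as its print ceiling)

Y. Giga and H. Miura (Comm. Math. Phys. **303** (2011) 289–300 = Hokkaido Univ. Preprint #956,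
Thm 1.1 with Remark 1.4) prove: a Type-I mild solution whose vorticity direction `ξ = ω/|ω|` has, on
the level sets `{|ω| > d}`, the PARABOLICALLY SCALED modulus of continuity
`|ξ(x,t) − ξ(y,t)| ≤ η(o(1)|x − y|/√(−t))` ((CA′); (CA) = fixed modulus is the special case
`o(1) = √(−t)`) does not blow up. The tree vendors both statements as named facts
(`Literature.Analysis.FluidPDE.gigaMiura2011_scaledAlignment_typeI`, `…gigaMiura_continuousAlignment_typeI`,
files `GigaMiura2011BlowupAnalysis`, `ContinuousAlignmentTypeI`) in its Leray–Hopf frame: a classical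
solution of viscosity `ν` on `ℝ³ × [0, T)`, Leray–Hopf from `u 0`, bounded on every `[0, T'] × ℝ³`,
`T' < T`, Type I at `T` (`IsTypeIBlowup u T`), conclusion `HasSmoothExtensionPast ν 0 u T`.

This file PROVES them (`gigaMiura2011_scaledAlignment_typeI_holds`,
`gigaMiura_continuousAlignment_typeI_holds`), following §2.1 of the paper with the two halves already
in the tree for the crux GAP″ of route `ScaledTopAlignment`:

* **Z, parabolic form** (`typeIZoom_ancientMild_limit_parabolic`): if `u` does NOT extend past `T`,
  the Type-I zoom about Leray near-maximum points (KNSS 2009 §6; tree `typeIZoom_ancientMild_limit`,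
  whose proof is repeated here only to RECORD the parabolic law of the zoom data it constructs:
  `λ_j² · (−s) = ν (T − t_j)` on the slice `s < 0`, and `t_j → T`) has a non-trivial Type-I ancient
  mild limit `W` each of whose slice vorticities `curl W(s)` is the pointwise limit of the vorticity
  zooms `(λ_j²/ν) ω(t_j, x_j + λ_j ·)`;
* **(CA′) passes to the limit** (`dir_eq_of_scaledAlignment_zoom`, the first half of the proof of
  Prop. 2.2, HUPS #956 p. 7: "`|ζ_k(x,t) − ζ_k(y,t)| ≤ η(o(1)|x − y|/√(−t)) → 0` … `ω(x,t) = |ω(x,t)| ζ₀(t)`"):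
  at two points `y, y'` where the limit vorticity is non-zero the physical vorticities exceed the
  level `d` eventually (`|ω| ≈ ν|Ω|/λ_j² → ∞`), the physical distance is `λ_j|y − y'|` and
  `√(ν(T − t_j)) = λ_j√(−s)`, so (CA′) bounds the chord of the two (scale-invariant) directions by
  `η(θ(t_j)|y − y'|/√(−s)) → η(0) = 0`; hence every slice vorticity of `W` is parallel to ONE vector
  (`exists_parallel_of_dir_eq`);
* **rigidity** (tree `unidirectionalVorticityLiouville`, Giga–Miura §2.1 p. 8 + Lemma 2.3 / Cor. 2.4 via
  KNSS 2009 Thm 5.1 / Remark 6.1 in the Type-I class): such a `W` vanishes identically — contradicting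
  `W(−1, 0) ≠ 0` (Prop. 2.1's non-triviality, here from Leray's rate).

No new definitions. The (CA) fact follows by the tree's reduction
`gigaMiura_continuousAlignment_typeI_of_scaledAlignment` (Remark 1.4).

## References

* Y. Giga, H. Miura, Comm. Math. Phys. 303 (2011) 289–300 = Hokkaido Univ. Preprint Series #956
  (2010): Thm 1.1, Rmk 1.4 (pp. 3–4), §2.1 Prop. 2.1–2.2, Lemma 2.3, Cor. 2.4 (pp. 5–9). [GigaMiura2011]
* G. Koch, N. Nadirashvili, G. Seregin, V. Šverák, Acta Math. 203 (2009) 83–105: Thm 5.1, §6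
  (Lemma 6.1, proof of Thm 6.2; Acta pp. 98–101). [KochNadirashviliSereginSverak2009]
* J. Leray, Acta Math. 63 (1934) 193–248, §19 (3.9). [Leray1934]
-/

noncomputable section

-- the summit and its single sub-problem share the name (CONVENTIONS §1), as in every Theorems file
set_option linter.dupNamespace false

open MeasureTheory Set Function Filter TopologicalSpace Metric
open scoped Topology NNReal ENNReal InnerProductSpace RealInnerProductSpace

namespace Summit.NavierStokesRegularity.NavierStokesRegularity.Theorems

open Literature.Analysis Literature.Analysis.FluidPDE

section Zoom

variable {ν T : ℝ} {u : ℝ → EuclideanSpace ℝ (Fin 3) → EuclideanSpace ℝ (Fin 3)}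
  {p : ℝ → EuclideanSpace ℝ (Fin 3) → ℝ}

/-- **The Type-I zoom limit with moving centres, parabolic form (Z).** Same statement as the tree's
`typeIZoom_ancientMild_limit` (KNSS 2009 §6 rescaling about Leray near-maximum points + the tree's
`C¹_loc` compactness `exists_tendsto_of_typeI_seq_Ioo`; non-triviality from Leray's rate), with the
PARABOLIC LAW of the zoom data recorded: on the slice `s < 0` the scales and times satisfy
`λ_j² (−s) = ν (T − t_j)` (the zoom at scale `λ_j = c_j√(νT)` reads the solution at the time
`t_j = T − c_j² T (−s)`), and `t_j → T`. For `ν > 0`, `T > 0`, a classical solution `(u, p)` on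
`ℝ³ × [0, T)`, Leray–Hopf from `u 0`, bounded on every `[0, T'] × ℝ³` (`T' < T`), with the Type-I
rate at `T` and no smooth extension past `T`: there are `C` and `W` with `IsTypeIAncientMild C W`,
`W(−1, 0) ≠ 0`, and for every `s < 0` centres `x_j`, times `t_j ∈ [0, T)`, `t_j → T`, scales
`λ_j → 0⁺` with `λ_j² (−s) = ν (T − t_j)` and `(λ_j²/ν) ω(t_j, x_j + λ_j y) → curl W(s)(y)` for all
`y`. [cite: KochNadirashviliSereginSverak2009, §6 Lemma 6.1 and proof of Thm 6.2 (Acta Math. 203 pp. 98–101)] -/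
theorem typeIZoom_ancientMild_limit_parabolic (hν : 0 < ν) (hT : 0 < T)
    (hsol : IsClassicalNSSolutionOn (Ico 0 T) ν 0 u p) (hLH : IsLerayHopfOn T ν 0 (u 0) u)
    (hslab : ∀ T' < T, ∃ M : ℝ, ∀ t ∈ Icc 0 T', ∀ x, ‖u t x‖ ≤ M)
    (hI : IsTypeIBlowup u T) (hext : ¬ HasSmoothExtensionPast ν 0 u T) :
    ∃ (C : ℝ) (W : ℝ → EuclideanSpace ℝ (Fin 3) → EuclideanSpace ℝ (Fin 3)),
      IsTypeIAncientMild C W ∧ W (-1) 0 ≠ 0 ∧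
      ∀ s < (0 : ℝ), ∃ (xc : ℕ → EuclideanSpace ℝ (Fin 3)) (t : ℕ → ℝ) (lam : ℕ → ℝ),
        (∀ j, t j ∈ Ico 0 T) ∧ Tendsto t atTop (𝓝 T) ∧ (∀ j, 0 < lam j) ∧
        Tendsto lam atTop (𝓝 0) ∧ (∀ j, lam j ^ 2 * (-s) = ν * (T - t j)) ∧
        ∀ y, Tendsto (fun j => (lam j ^ 2 / ν) • curl (u (t j)) (xc j + lam j • y)) atTop
          (𝓝 (curl (W s) y)) := by
  -- adapted from the tree's `typeIZoom_ancientMild_limit` (same construction; two extra conclusions)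
  have hbdd : ∀ T₁ ∈ Ioo 0 T, ∃ M : ℝ, ∀ t ∈ Icc 0 T₁, ∀ x, ‖u t x‖ ≤ M :=
    fun T₁ hT₁ => hslab T₁ hT₁.2
  -- Steps 1–2: Leray points and the global rate
  obtain ⟨c₀, hc₀, hlow⟩ := exists_lerayRate_points hν hT hsol hLH hbdd hext
  obtain ⟨C₁, hrate⟩ := exists_global_typeI_rate (u := u) hT hbdd hI
  -- Step 3: scales
  set R : ℝ := Real.sqrt (ν * T) with hRdef
  have hR : 0 < R := Real.sqrt_pos.2 (mul_pos hν hT)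
  have hR2 : R ^ 2 = ν * T := by rw [hRdef, Real.sq_sqrt (mul_pos hν hT).le]
  set α : ℝ := R / ν with hα
  set β : ℝ := R ^ 2 / ν with hβ
  have hν0 : ν ≠ 0 := hν.ne'
  have hβT : β = T := by
    rw [hβ, hR2]; field_simp
  have hβpos : 0 < β := by rw [hβT]; exact hT
  set c : ℕ → ℝ := fun k => 1 / ((k : ℝ) + 2) with hcdef
  have hc : ∀ k, 0 < c k := fun k => by rw [hcdef]; positivity
  have hc0 : Tendsto c atTop (𝓝 0) := by
    have h := (tendsto_one_div_add_atTop_nhds_zero_nat (𝕜 := ℝ)).comp (tendsto_add_atTop_nat 1)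
    refine h.congr fun k => ?_
    simp only [hcdef, comp_apply, Nat.cast_add, Nat.cast_one]
    ring
  -- the windows `(A k, 0)`, `A k = -(T/(c_k² β)) = -(k+2)²`
  set A : ℕ → ℝ := fun k => -(T / (c k ^ 2 * β)) with hAdef
  have hAk : ∀ k, A k = -(((k : ℝ) + 2) ^ 2) := fun k => by
    simp only [hAdef, hcdef, hβT]
    field_simp
  have hA : Tendsto A atTop atBot := by
    have h1 : Tendsto (fun k : ℕ => ((k : ℝ) + 2) ^ 2) atTop atTop := by
      refine tendsto_atTop_mono (fun k => ?_)
        (tendsto_atTop_add_const_right _ 2 tendsto_natCast_atTop_atTop)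
      nlinarith [(Nat.cast_nonneg k : (0 : ℝ) ≤ k)]
    exact (tendsto_neg_atTop_atBot.comp h1).congr fun k => (hAk k).symm
  -- `-1` lies in every window
  have hm1 : ∀ k, (-1 : ℝ) ∈ Ioo (-(T / (c k ^ 2 * β))) 0 := fun k => by
    refine ⟨?_, by norm_num⟩
    show A k < -1
    rw [hAk]
    nlinarith [(Nat.cast_nonneg k : (0 : ℝ) ≤ k)]
  -- the near-maximum centres at the times `t_k = T - c_k² β`
  set tk : ℕ → ℝ := fun k => T + c k ^ 2 * β * (-1) with htkdef
  have htk : ∀ k, tk k ∈ Ico 0 T := fun k => (zoom_time_mem (T := T) (hc k) hβpos le_rfl (hm1 k)).2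
  choose xk hxk using fun k => hlow (tk k) (htk k)
  -- the zooms
  set w : ℕ → ℝ → EuclideanSpace ℝ (Fin 3) → EuclideanSpace ℝ (Fin 3) :=
    fun k => (c k * α) • stPull (c k ^ 2 * β) (c k * R) T (xk k) u with hwdef
  have hcw : ∀ k, ContinuousOn (uncurry (w k)) (Ioo (A k) 0 ×ˢ univ) := fun k =>
    zoom_continuousOn (x₀ := xk k) hν hsol hR hα hβ (hc k) le_rfl
  have hdivw : ∀ k, ∀ t ∈ Ioo (A k) 0, IsWeaklyDivFree (w k t) := fun k t ht =>
    zoom_isWeaklyDivFree (x₀ := xk k) hν hsol hR hα hβ (hc k) le_rfl ht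
  have hmild : ∀ k, ∀ s t : ℝ, A k < s → s < t → t < 0 → ∀ x,
      w k t x = UnboundedOperators.heatExtension (w k s) (t - s) x -
        oseenDuhamel 1 s (w k) (w k) t x := fun k s t hs hst ht x =>
    zoom_oseen_of_slab (x₀ := xk k) hν hT hsol hLH hbdd hR hα hβ (hc k) le_rfl hs hst ht x
  have hIw : ∀ k, ∀ t ∈ Ioo (A k) 0, ∀ x, ‖w k t x‖ ≤ (α * C₁ / Real.sqrt β) / Real.sqrt (-t) :=
    fun k t ht x => zoom_norm_le (T := T) (x₀ := xk k) (u := u) hR hα hβ hν (hc k) le_rfl hrate ht x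
  -- Step 4: extraction
  obtain ⟨φ, hφ, W, hW, hpt, hptD, -, -⟩ :=
    exists_tendsto_of_typeI_seq_Ioo (α * C₁ / Real.sqrt β) hA hcw hdivw hmild hIw
  have hφt : Tendsto φ atTop atTop := hφ.tendsto_atTop
  -- Step 5: non-triviality at `(-1, 0)`
  have hsqrt : ∀ k, Real.sqrt (T - tk k) = c k * Real.sqrt T := fun k => by
    have e : T - tk k = (c k) ^ 2 * T := by simp only [htkdef, hβT]; ring
    rw [e, Real.sqrt_mul (sq_nonneg _), Real.sqrt_sq (hc k).le]
  have hkey : ∀ k, c k * α * (c₀ * Real.sqrt ν / Real.sqrt (T - tk k) / 2) = c₀ / 2 := fun k => by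
    rw [hsqrt k, hα, hRdef, Real.sqrt_mul hν.le]
    have hsν : Real.sqrt ν ≠ 0 := (Real.sqrt_pos.2 hν).ne'
    have hsT : Real.sqrt T ≠ 0 := (Real.sqrt_pos.2 hT).ne'
    have hck : c k ≠ 0 := (hc k).ne'
    have e1 : Real.sqrt ν * Real.sqrt T / ν = Real.sqrt T / Real.sqrt ν := by
      rw [div_eq_div_iff hν0 hsν]
      calc Real.sqrt ν * Real.sqrt T * Real.sqrt ν
          = Real.sqrt T * (Real.sqrt ν * Real.sqrt ν) := by ring
        _ = Real.sqrt T * ν := by rw [Real.mul_self_sqrt hν.le]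
    rw [e1]
    field_simp
  have hwk : ∀ k, c₀ / 2 ≤ ‖w k (-1) 0‖ := fun k => by
    have e : w k (-1) 0 = (c k * α) • u (tk k) (xk k) := by
      simp only [hwdef, smul_stPull_apply, smul_zero, add_zero, htkdef]
    rw [e, norm_smul, Real.norm_of_nonneg (by positivity : (0 : ℝ) ≤ c k * α), ← hkey k]
    exact mul_le_mul_of_nonneg_left (hxk k) (by positivity)
  have hW0 : W (-1) 0 ≠ 0 := by
    have hlim : c₀ / 2 ≤ ‖W (-1) 0‖ :=
      ge_of_tendsto' ((hpt (-1) (by norm_num) 0).norm) fun j => hwk (φ j)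
    intro h
    rw [h, norm_zero] at hlim
    linarith
  refine ⟨α * C₁ / Real.sqrt β, W, hW, hW0, fun s hs => ?_⟩
  -- Step 6: the slice `s < 0`
  have hAφ : Tendsto (fun j => A (φ j)) atTop atBot := hA.comp hφt
  obtain ⟨j₀, hj₀⟩ : ∃ j₀ : ℕ, ∀ j, j₀ ≤ j → A (φ j) < s :=
    eventually_atTop.1 (hAφ.eventually (eventually_lt_atBot s))
  set k : ℕ → ℕ := fun j => φ (j + j₀) with hkdef
  have hks : ∀ j, s ∈ Ioo (-(T / (c (k j) ^ 2 * β))) 0 := fun j =>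
    ⟨hj₀ (j + j₀) (Nat.le_add_left _ _), hs⟩
  have hck0 : Tendsto (fun j => c (k j)) atTop (𝓝 0) :=
    (hc0.comp hφt).comp (tendsto_add_atTop_nat j₀)
  refine ⟨fun j => xk (k j), fun j => T + c (k j) ^ 2 * β * s, fun j => c (k j) * R,
    fun j => (zoom_time_mem (T := T) (hc (k j)) hβpos le_rfl (hks j)).2, ?_,
    fun j => mul_pos (hc (k j)) hR, ?_, fun j => ?_, fun y => ?_⟩
  · -- `t_j → T`
    have h := ((hck0.pow 2).mul_const (β * s)).const_add T
    rw [zero_pow two_ne_zero, zero_mul, add_zero] at h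
    exact h.congr fun j => by ring
  · have h := hck0.mul_const R
    rw [zero_mul] at h
    exact h
  · -- the parabolic law `λ_j² (-s) = ν (T - t_j)`
    rw [mul_pow, hR2, hβT]
    ring
  · have key : ∀ j, ((c (k j) * R) ^ 2 / ν) • curl (u (T + c (k j) ^ 2 * β * s))
        (xk (k j) + (c (k j) * R) • y) = curl (w (k j) s) y := fun j => by
      rw [hwdef, curl_smul_stPull]
      congr 1
      rw [hα]
      field_simp
    simp_rw [key]
    have hD : Tendsto (fun j => fderiv ℝ (w (k j) s) y) atTop (𝓝 (fderiv ℝ (W s) y)) :=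
      (hptD s hs y).comp (tendsto_add_atTop_nat j₀)
    show Tendsto (fun j => curlCLM (fderiv ℝ (w (k j) s) y)) atTop (𝓝 (curlCLM (fderiv ℝ (W s) y)))
    exact (curlCLM.continuous.tendsto _).comp hD

end Zoom

/-! ### (CA′) passes to the limit along a parabolic zoom -/

section Passage

variable {ν T : ℝ} {u : ℝ → EuclideanSpace ℝ (Fin 3) → EuclideanSpace ℝ (Fin 3)}

/-- **(CA′) kills the direction modulus along a parabolic zoom** (Giga–Miura 2011, proof of Prop. 2.2,
first step, HUPS #956 p. 7: "`|ζ_k(x,t) − ζ_k(y,t)| ≤ η(o(1)|x − y|/√(−t))` for `x, y ∈ K` … Sending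
`k → ∞` … `ω(x,t) = |ω(x,t)| ζ₀(t)`"). Let `u` satisfy (CA′) = `HasScaledContinuousAlignment ν T u`
and let a vorticity zoom `y ↦ (λ_j²/ν) ω(t_j, x_j + λ_j y)` with `t_j ∈ [0, T)`, `t_j → T`, `λ_j → 0⁺`
and the parabolic law `λ_j² (−s) = ν (T − t_j)` (`s < 0` fixed) converge pointwise to `Ω`. Then at any
two points where `Ω ≠ 0` the directions agree: `Ω(y)/|Ω(y)| = Ω(y')/|Ω(y')|`. Proof: the physical
vorticities `|ω(t_j, x_j + λ_j y)| ≈ ν|Ω(y)|/λ_j² → ∞` exceed the level `d` eventually, the physical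
distance is `λ_j|y − y'|` and `√(ν(T − t_j)) = λ_j√(−s)`, so (CA′) bounds the chord of the two
directions (invariant under the positive rescaling) by `η(θ(t_j)|y − y'|/√(−s)) → η(0) = 0`.
[cite: GigaMiura2011, Prop. 2.2, proof, first step (§2.1; HUPS preprint #956 p. 7)] -/
theorem dir_eq_of_scaledAlignment_zoom (hν : 0 < ν) (hT : 0 < T)
    (hCA : HasScaledContinuousAlignment ν T u) {s : ℝ} (hs : s < 0)
    {xc : ℕ → EuclideanSpace ℝ (Fin 3)} {t : ℕ → ℝ} {lam : ℕ → ℝ}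
    {Ω : EuclideanSpace ℝ (Fin 3) → EuclideanSpace ℝ (Fin 3)}
    (ht : ∀ j, t j ∈ Ico 0 T) (htT : Tendsto t atTop (𝓝 T)) (hlam : ∀ j, 0 < lam j)
    (hlam0 : Tendsto lam atTop (𝓝 0)) (hpar : ∀ j, lam j ^ 2 * (-s) = ν * (T - t j))
    (hconv : ∀ y, Tendsto (fun j => (lam j ^ 2 / ν) • curl (u (t j)) (xc j + lam j • y)) atTop
      (𝓝 (Ω y))) :
    ∀ y y', Ω y ≠ 0 → Ω y' ≠ 0 → ‖Ω y‖⁻¹ • Ω y = ‖Ω y'‖⁻¹ • Ω y' := by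
  obtain ⟨d, hd, η, θ, hmono, hηc, hη0, hθ0, hθ, hmod⟩ := hCA
  intro y y' hy hy'
  -- shorthand: physical points, vorticities and the positive scaling factor
  set P : ℕ → EuclideanSpace ℝ (Fin 3) := fun j => xc j + lam j • y with hP
  set P' : ℕ → EuclideanSpace ℝ (Fin 3) := fun j => xc j + lam j • y' with hP'
  set a : ℕ → EuclideanSpace ℝ (Fin 3) := fun j => curl (u (t j)) (P j) with ha
  set b : ℕ → EuclideanSpace ℝ (Fin 3) := fun j => curl (u (t j)) (P' j) with hb
  have hcpos : ∀ j, 0 < lam j ^ 2 / ν := fun j => div_pos (pow_pos (hlam j) 2) hν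
  have hca : Tendsto (fun j => (lam j ^ 2 / ν) • a j) atTop (𝓝 (Ω y)) := hconv y
  have hcb : Tendsto (fun j => (lam j ^ 2 / ν) • b j) atTop (𝓝 (Ω y')) := hconv y'
  -- normalisation: continuous at non-zero limits, invariant under positive scaling
  have hdir : ∀ (v : ℕ → EuclideanSpace ℝ (Fin 3)) (w : EuclideanSpace ℝ (Fin 3)), w ≠ 0 →
      Tendsto (fun j => (lam j ^ 2 / ν) • v j) atTop (𝓝 w) →
      Tendsto (fun j => ‖v j‖⁻¹ • v j) atTop (𝓝 (‖w‖⁻¹ • w)) := by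
    intro v w hw hv
    have h1 : Tendsto (fun j => ‖(lam j ^ 2 / ν) • v j‖⁻¹ • ((lam j ^ 2 / ν) • v j)) atTop
        (𝓝 (‖w‖⁻¹ • w)) := ((hv.norm).inv₀ (norm_ne_zero_iff.mpr hw)).smul hv
    refine h1.congr fun j => ?_
    rw [norm_smul, Real.norm_of_nonneg (hcpos j).le, mul_inv, smul_smul, mul_comm (lam j ^ 2 / ν)⁻¹,
      mul_assoc, inv_mul_cancel₀ (hcpos j).ne', mul_one]
  have hda := hdir a (Ω y) hy hca
  have hdb := hdir b (Ω y') hy' hcb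
  -- the chord of the directions converges to the chord of the limit directions
  have hchord : Tendsto (fun j => ‖‖a j‖⁻¹ • a j - ‖b j‖⁻¹ • b j‖) atTop
      (𝓝 ‖‖Ω y‖⁻¹ • Ω y - ‖Ω y'‖⁻¹ • Ω y'‖) := (hda.sub hdb).norm
  -- the scaling factor tends to zero, so the physical vorticities exceed the level `d` eventually
  have hc0 : Tendsto (fun j => lam j ^ 2 / ν) atTop (𝓝 0) := by
    have h := (hlam0.pow 2).div_const ν
    rwa [zero_pow two_ne_zero, zero_div] at h
  have hlarge : ∀ (v : ℕ → EuclideanSpace ℝ (Fin 3)) (w : EuclideanSpace ℝ (Fin 3)), w ≠ 0 →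
      Tendsto (fun j => (lam j ^ 2 / ν) • v j) atTop (𝓝 w) → ∀ᶠ j in atTop, d < ‖v j‖ := by
    intro v w hw hv
    have hwpos : 0 < ‖w‖ := norm_pos_iff.mpr hw
    have h1 : ∀ᶠ j in atTop, ‖w‖ / 2 < ‖(lam j ^ 2 / ν) • v j‖ :=
      (hv.norm).eventually_const_lt (by linarith)
    have h2 : ∀ᶠ j in atTop, lam j ^ 2 / ν < ‖w‖ / (2 * (d + 1)) :=
      hc0.eventually_lt_const (by positivity)
    filter_upwards [h1, h2] with j h1j h2j
    rw [norm_smul, Real.norm_of_nonneg (hcpos j).le] at h1j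
    by_contra hle
    push Not at hle
    have h3 : lam j ^ 2 / ν * ‖v j‖ ≤ ‖w‖ / (2 * (d + 1)) * d :=
      mul_le_mul h2j.le hle (norm_nonneg _) (by positivity)
    have h4 : ‖w‖ / (2 * (d + 1)) * d < ‖w‖ / 2 := by
      rw [div_mul_eq_mul_div, div_lt_div_iff₀ (by positivity) (by positivity)]
      nlinarith
    linarith
  have hea := hlarge a (Ω y) hy hca
  have heb := hlarge b (Ω y') hy' hcb
  -- `t_j → T` from the left, so `t_j > 0` eventually and `θ(t_j) → 0`
  have htpos : ∀ᶠ j in atTop, 0 < t j := htT.eventually_const_lt hT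
  have htW : Tendsto t atTop (𝓝[<] T) :=
    tendsto_nhdsWithin_iff.2 ⟨htT, Eventually.of_forall fun j => (ht j).2⟩
  have hθt : Tendsto (fun j => θ (t j)) atTop (𝓝 0) := hθ.comp htW
  -- the argument of the modulus tends to `0` within `[0, ∞)`, hence `η` of it tends to `η 0 = 0`
  set K : ℝ := ‖y - y'‖ / Real.sqrt (-s) with hK
  have hK0 : 0 ≤ K := by positivity
  have harg : Tendsto (fun j => θ (t j) * K) atTop (𝓝[≥] 0) := by
    refine tendsto_nhdsWithin_iff.2 ⟨?_, Eventually.of_forall fun j => mul_nonneg (hθ0 _) hK0⟩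
    have h := hθt.mul_const K
    rwa [zero_mul] at h
  have hηlim : Tendsto (fun j => η (θ (t j) * K)) atTop (𝓝 0) := by
    have hcont : ContinuousWithinAt η (Ici 0) 0 := hηc 0 (mem_Ici.2 le_rfl)
    have h := hcont.tendsto.comp harg
    rwa [hη0] at h
  -- (CA′) at the two physical points, rewritten in zoom variables
  have hbound : ∀ᶠ j in atTop, ‖‖a j‖⁻¹ • a j - ‖b j‖⁻¹ • b j‖ ≤ η (θ (t j) * K) := by
    filter_upwards [hea, heb, htpos] with j hja hjb hjt
    have hms := hmod (t j) ⟨hjt, (ht j).2⟩ (P j) (P' j) hja hjb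
    rw [vorticityDirection_apply, vorticityDirection_apply] at hms
    have hdist : ‖P j - P' j‖ = lam j * ‖y - y'‖ := by
      have e : P j - P' j = lam j • (y - y') := by
        simp only [hP, hP', smul_sub]; abel
      rw [e, norm_smul, Real.norm_of_nonneg (hlam j).le]
    have hsq : Real.sqrt (ν * (T - t j)) = lam j * Real.sqrt (-s) := by
      rw [← hpar j, Real.sqrt_mul (sq_nonneg _), Real.sqrt_sq (hlam j).le]
    have harg_eq : θ (t j) * ‖P j - P' j‖ / Real.sqrt (ν * (T - t j)) = θ (t j) * K := by
      rw [hdist, hsq, hK]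
      have hl : lam j ≠ 0 := (hlam j).ne'
      have hss : Real.sqrt (-s) ≠ 0 := (Real.sqrt_pos.2 (neg_pos.2 hs)).ne'
      field_simp
    rw [harg_eq] at hms
    exact hms
  -- pass to the limit: the chord of the limit directions is `≤ 0`
  have hle : ‖‖Ω y‖⁻¹ • Ω y - ‖Ω y'‖⁻¹ • Ω y'‖ ≤ 0 :=
    le_of_tendsto_of_tendsto hchord hηlim hbound
  have h0 : ‖‖Ω y‖⁻¹ • Ω y - ‖Ω y'‖⁻¹ • Ω y'‖ = 0 := le_antisymm hle (norm_nonneg _)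
  rw [norm_eq_zero, sub_eq_zero] at h0
  exact h0

end Passage

/-- A field whose directions agree wherever it is non-zero is everywhere parallel to ONE non-zero
vector (the zero field is parallel to any vector). [folklore] -/
theorem exists_parallel_of_dir_eq {Ω : EuclideanSpace ℝ (Fin 3) → EuclideanSpace ℝ (Fin 3)}
    (h : ∀ y y', Ω y ≠ 0 → Ω y' ≠ 0 → ‖Ω y‖⁻¹ • Ω y = ‖Ω y'‖⁻¹ • Ω y') :
    ∃ e : EuclideanSpace ℝ (Fin 3), e ≠ 0 ∧ ∀ y, ∃ a : ℝ, Ω y = a • e := by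
  by_cases h0 : ∀ y, Ω y = 0
  · exact exists_parallel_of_zero_or_signBlindAligned (Or.inl h0)
  · push Not at h0
    obtain ⟨y₀, hy₀⟩ := h0
    refine ⟨Ω y₀, hy₀, fun y => ?_⟩
    by_cases hy : Ω y = 0
    · exact ⟨0, by rw [hy, zero_smul]⟩
    · refine ⟨‖Ω y‖ * ‖Ω y₀‖⁻¹, ?_⟩
      have hyy := h y y₀ hy hy₀
      calc Ω y = ‖Ω y‖ • (‖Ω y‖⁻¹ • Ω y) := by
            rw [smul_smul, mul_inv_cancel₀ (norm_ne_zero_iff.2 hy), one_smul]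
        _ = ‖Ω y‖ • (‖Ω y₀‖⁻¹ • Ω y₀) := by rw [hyy]
        _ = (‖Ω y‖ * ‖Ω y₀‖⁻¹) • Ω y₀ := by rw [smul_smul]

/-! ### Theorem 1.1 under (CA′), and under (CA) -/

/-- **Giga–Miura 2011, Theorem 1.1 under (CA′) (Remark 1.4), PROVED** — discharge of the named fact
`Literature.Analysis.FluidPDE.gigaMiura2011_scaledAlignment_typeI` in the tree's Leray–Hopf frame:
for `ν > 0`, `T > 0`, a classical solution `(u, p)` on `ℝ³ × [0, T)`, Leray–Hopf from `u 0`, bounded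
on every `[0, T'] × ℝ³` (`T' < T`), Type I at `T`, whose vorticity direction obeys the parabolically
scaled modulus (CA′) on `{|ω| > d}`, the solution extends smoothly past `T`. Proof (§2.1 of the paper):
otherwise the Type-I zoom about Leray near-maximum points (`typeIZoom_ancientMild_limit_parabolic`)
has a non-trivial Type-I ancient mild limit `W`; (CA′) dies along the zoom
(`dir_eq_of_scaledAlignment_zoom`), so every slice vorticity of `W` is parallel to one vector
(`exists_parallel_of_dir_eq`); Giga–Miura's rigidity (`unidirectionalVorticityLiouville`: §2.1 p. 8,
Lemma 2.3 / Cor. 2.4 through KNSS 2009 Thm 5.1 / Remark 6.1) forces `W ≡ 0` — contradiction.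
[cite: GigaMiura2011, Thm 1.1 with Remark 1.4 (CA′) (§1, HUPS preprint #956 pp. 3–4; proof §2.1 pp. 5–9)] -/
theorem gigaMiura2011_scaledAlignment_typeI_holds :
    Literature.Analysis.FluidPDE.gigaMiura2011_scaledAlignment_typeI := by
  intro ν T hν hT u p hsol hLH hslab hI hCA
  by_contra hext
  obtain ⟨C, W, hW, hW0, hzoom⟩ :=
    typeIZoom_ancientMild_limit_parabolic hν hT hsol hLH hslab hI hext
  have hdirW : ∀ s < (0 : ℝ), ∃ e : EuclideanSpace ℝ (Fin 3), e ≠ 0 ∧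
      ∀ y, ∃ a : ℝ, curl (W s) y = a • e := by
    intro s hs
    obtain ⟨xc, t, lam, ht, htT, hlam, hlam0, hpar, hconv⟩ := hzoom s hs
    exact exists_parallel_of_dir_eq
      (dir_eq_of_scaledAlignment_zoom hν hT hCA hs ht htT hlam hlam0 hpar hconv)
  exact hW0 (unidirectionalVorticityLiouville hW hdirW (-1) (by norm_num) 0)

/-- **Giga–Miura 2011, Theorem 1.1 (continuous alignment (CA) under Type I excludes blow-up), PROVED**
— discharge of the named fact `Literature.Analysis.FluidPDE.gigaMiura_continuousAlignment_typeI`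
(Giga–Gu–Hsu 2019 Thm 1.1 restating Giga–Miura 2011; tree frame as in `ContinuousAlignmentTypeI`):
(CA) is (CA′) with `o(1) = √(ν(T − t))` (`gigaMiura_continuousAlignment_typeI_of_scaledAlignment`,
Remark 1.4), and the (CA′) theorem is `gigaMiura2011_scaledAlignment_typeI_holds`.
[cite: GigaMiura2011, Thm 1.1 (§1, HUPS preprint #956 p. 3; as restated in GigaGuHsu2019 Thm 1.1 p. 2)] -/
theorem gigaMiura_continuousAlignment_typeI_holds :
    Literature.Analysis.FluidPDE.gigaMiura_continuousAlignment_typeI :=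
  gigaMiura_continuousAlignment_typeI_of_scaledAlignment gigaMiura2011_scaledAlignment_typeI_holds

end Summit.NavierStokesRegularity.NavierStokesRegularity.Theorems

end
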